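import Summits.BirchSwinnertonDyer.BirchSwinnertonDyer.Theses.ShadowIsolation
import Summits.BirchSwinnertonDyer.BirchSwinnertonDyer.Theorems.ShadowIsolationIsolationOfAccidentalZerosStubDepthRigidity
import Summits.BirchSwinnertonDyer.BirchSwinnertonDyer.Theorems.ShadowIsolationIsolationOfAccidentalZerosStubRationalSectorFinite
import Literature.NumberTheory.EllipticCurves.EichlerShimuraCongruenceHondaProofs
import Literature.NumberTheory.EllipticCurves.NewformsCoeffFieldHolds

/-!
# Line `orbit-dichotomy` for crux `ShadowIsolation.IsolationOfAccidentalZeros`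
# (stmt-BirchSwinnertonDyer-15786, route `route-BirchSwinnertonDyer-ShadowIsolation`, crux rank 2)

Strategist line (unit `cstrat-stmt-BirchSwinnertonDyer-15786-b1`, 2026-08-17). An ALTERNATIVE cut of the
crux to the registered line `birth` (rational / irrational sectors). Here the cut is by the DEGREE
`d(g) = [ℚ(aₙ(g)) : ℚ]` of the coefficient field of a deep congruent newform `g`, at an EXISTENTIAL
threshold `d₀ = d₀(E, p)`:

* `d(g) ≤ 1` (rational): deep congruent rational newforms do not exist — PROVED below
  (`rationalDeath`) from the two landed theorems of line `birth` (`Theorems.stub_depthRigidity`,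
  `Theorems.stub_rationalSectorFinite`: Atkin–Lehner + Shimura integrality; Eichler–Shimura +
  Carayol + Mordell–Faltings on the twists of `X_E(pⁿ)`), modulo the named facts `exists_isNewformOf`
  (modularity, BCDT) and `DeepCongruenceFinite` (Faltings), which are the two fact-stubs;
* `2 ≤ d(g) ≤ d` for each fixed `d` (**`stub_boundedDegreeGrowth`**, the DIOPHANTINE stub): deep
  congruent IRRATIONAL newforms of bounded degree do not exist — no `L`-value, no sign in it; it says
  `d(g) → ∞` with the depth of the congruence. Engine: a newform `g` of degree `d` congruent to `E`
  modulo `𝔭ⁿ` is a `ℚ`-point of a twist of a `d`-dimensional Hilbert–Blumenthal moduli variety with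
  full `E[pⁿ]`-level structure, of general type and Brody/Kobayashi-hyperbolic modulo boundary for
  `pⁿ ≫_d 0` (Brunebarbe 2020; Abramovich–Várilly-Alvarado 2017/18); LANG–VOJTA then leaves finitely
  many `g`, each of bounded depth (stub K). Unconditional sub-sectors: `d = 1` (above) and the
  restriction-of-scalars (`ℚ`-curve) part of `d = 2` (quadratic points on twists of `X_E(pⁿ)` are finite
  for `pⁿ ≫ 0` by Abramovich's gonality bound + Faltings);
* `d(g) > d₀` (**`stub_largeOrbitNonvanishing`**, the ANALYTIC stub = the open core): at large depth,
  an even-sign congruent newform of large degree has SOME Galois-conjugate newform `g^σ` (same level,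
  same Atkin–Lehner signs) with `L(g^σ, 1) ≠ 0`. Intended engine: level-aspect Maeda-type DOMINANCE of
  deep congruence orbits inside their Atkin–Lehner class (K. Martin 2021, Lipnowski–Schaeffer 2020,
  Dieulefait–Pacetti–Tsaknias 2021) + uniform POSITIVE-PROPORTION non-vanishing of central values of
  even forms in the squarefree-level aspect (Iwaniec–Sarnak 2000): a dominant orbit cannot vanish
  entirely. The threshold `d₀` is what lets the analytic side ASSUME a large orbit;
* **`stub_conjugateZeros`** (Shimura 1977, Thm. 1; THEOREM): central vanishing is a property of the
  Galois orbit: if `L(g, 1) = 0` then `L(g^σ, 1) = 0` for every conjugate newform.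

The composition `IsolationOfAccidentalZeros_of` is pure logic (trichotomy in `d(g)`), sorry-free,
and concludes the crux BY NAME. Why it dodges the stuck goal of `birth`: `birth`'s open stub
`stub_irrationalShadowsFinite` is the crux verbatim on the irrational sector; here the irrational
sector is split ONCE MORE at an existential degree threshold, so that (i) everything of bounded
degree becomes an `L`-FREE Diophantine finiteness statement with a named engine (Faltings /
Lang–Vojta / hyperbolicity of level covers), and (ii) the analytic statement is only asked in the
large-orbit regime where orbit dominance + positive-proportion non-vanishing have a grip. No stub is
the crux: `I ⇒` each stub trivially, and no stub alone gives `I`.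

Disproof.lean: none exists for this crux (no `_false_without_` obstruction to honour; checked
`ledger crux ls` 2026-08-17T08:30Z). The hypotheses `5 ≤ p`, `HasIrreducibleModPGaloisRep` are
consumed by `rationalDeath` (through `stub_rationalSectorFinite`) and by the Diophantine stub
(Carayol needs absolute irreducibility; `pⁿ ≥ 7`).
-/

set_option linter.unusedVariables false
set_option linter.dupNamespace false

noncomputable section

namespace Summit.BirchSwinnertonDyer.BirchSwinnertonDyer.Cruxes.IsolationOfAccidentalZeros.OrbitDichotomy

open scoped MatrixGroups ModularForm
open CongruenceSubgroup UpperHalfPlane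
open Summit.BirchSwinnertonDyer.BirchSwinnertonDyer.Theses.ShadowIsolation
open Literature.NumberTheory.EllipticCurves Literature.NumberTheory.EllipticCurves.ModularForms

/-! ## Vocabulary of the line (local definitions; every clause is a clause of the crux) -/

section Vocabulary

variable (W : WeierstrassCurve ℚ) [W.IsGloballyMinimal] (p : ℕ)

/-- Depth-`n` congruence of `g ∈ S₂(Γ₀(N_W·M))` to `W` off `N_W·M`: the crux's congruence clause
(a ring homomorphism `φ : R → ℤ/pⁿ` on a subring `R ⊆ ℂ` containing the `a_ℓ(g)`, `ℓ ∤ N_W·M`, with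
`φ(a_ℓ(g)) = a_ℓ(W)`); the `NeZero` witness is carried inside, as in the crux. -/
def CongruentAt (n M : ℕ) (g : CuspForm (Gamma0 (W.conductorNorm ℤ * M)) 2) : Prop :=
  ∃ (_ : NeZero (W.conductorNorm ℤ * M)) (R : Subring ℂ) (φ : R →+* ZMod (p ^ n))
    (hR : ∀ ℓ : ℕ, ℓ.Prime → ¬ ℓ ∣ W.conductorNorm ℤ * M → heckeEigenvalue g ℓ ∈ R),
    ∀ (ℓ : ℕ) (hℓ : ℓ.Prime) (hℓL : ¬ ℓ ∣ W.conductorNorm ℤ * M),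
      φ ⟨heckeEigenvalue g ℓ, hR ℓ hℓ hℓL⟩ = ((W.frobeniusTrace ℓ : ℤ) : ZMod (p ^ n))

/-- Level-raising data of the crux: `M` squarefree and coprime to `p·N_W`, `g` a newform of level
`N_W·M` whose `q`-expansion is not `(aₘ(W))ₘ`. -/
def IsRaisedNewform (M : ℕ) [NeZero (W.conductorNorm ℤ * M)]
    (g : CuspForm (Gamma0 (W.conductorNorm ℤ * M)) 2) : Prop :=
  Squarefree M ∧ Nat.Coprime M (p * W.conductorNorm ℤ) ∧ IsNewform0 g ∧
    ∃ m : ℕ, (qExpansion 1 ⇑g).coeff m ≠ ((W.LFunction m : ℤ) : ℂ)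

/-- Even sign: Fricke eigenvalue `−1` (the crux's clause `w g = −g`, `w = S·diag(N_W·M, 1)`). -/
def HasEvenSign (M : ℕ) [NeZero (W.conductorNorm ℤ * M)]
    (g : CuspForm (Gamma0 (W.conductorNorm ℤ * M)) 2) : Prop :=
  cuspHeckeOperatorₗ (CongruenceSubgroup.Gamma0 (W.conductorNorm ℤ * M)) 2
      (slToGLPos ModularGroup.S * diagGL ((W.conductorNorm ℤ * M : ℕ) : ℚ) 1
        (Nat.cast_pos.mpr (NeZero.pos (W.conductorNorm ℤ * M))) one_pos) g = -g

end Vocabulary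

/-- Central zero: the `L`-series `Σ aₘ(g) m^{-s}` (`re s > 2`) has an entire continuation vanishing
at `s = 1` (the crux's last clause). -/
def HasCentralZero {L : ℕ} (g : CuspForm (Gamma0 L) 2) : Prop :=
  ∃ Λ : ℂ → ℂ, Differentiable ℂ Λ ∧
    (∀ s : ℂ, 2 < s.re → Λ s = LSeries (fun m ↦ (qExpansion 1 ⇑g).coeff m) s) ∧ Λ 1 = 0

/-- Degree at most `d`: the coefficient field `ℚ(aₘ(g) : m)` (`coeffField`) is a number field of
degree `≤ d` (finite-dimensionality is part of the predicate, so the junk value `finrank = 0` of an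
infinite-dimensional field never counts as small degree). -/
def HasDegreeLE {L : ℕ} (g : CuspForm (Gamma0 L) 2) (d : ℕ) : Prop :=
  FiniteDimensional ℚ (coeffField g) ∧ Module.finrank ℚ (coeffField g) ≤ d

/-- `g'` is a Galois conjugate of `g`: some ring automorphism of `ℂ` carries the `q`-expansion of
`g` to that of `g'` coefficientwise. -/
def IsConjugate {L : ℕ} (g g' : CuspForm (Gamma0 L) 2) : Prop :=
  ∃ σ : ℂ ≃+* ℂ, ∀ m : ℕ, (qExpansion 1 ⇑g').coeff m = σ ((qExpansion 1 ⇑g).coeff m)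

variable {W : WeierstrassCurve ℚ} [W.IsGloballyMinimal] {p : ℕ}

/-- Depth monotonicity: a depth-`n` congruence restricts to depth `m ≤ n` (compose with
`ℤ/pⁿ → ℤ/pᵐ`). -/
theorem CongruentAt.mono {m n M : ℕ} (hmn : m ≤ n)
    {g : CuspForm (Gamma0 (W.conductorNorm ℤ * M)) 2} :
    CongruentAt W p n M g → CongruentAt W p m M g := by
  rintro ⟨hM, R, φ, hR, hcong⟩
  refine ⟨hM, R, (ZMod.castHom (pow_dvd_pow p hmn) (ZMod (p ^ m))).comp φ, hR, ?_⟩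
  intro ℓ hℓ hℓL
  rw [RingHom.comp_apply, hcong ℓ hℓ hℓL, map_intCast]

/-- A newform of degree `≤ 1` has INTEGER `q`-expansion: its coefficient field is `ℚ` and its
coefficients are algebraic integers (Shimura 1971, Thm. 3.48, `IsNewform0.isIntegral_coeff_holds`),
hence rational integers (`ℤ` is integrally closed). -/
theorem intCoeff_of_hasDegreeLE_one {L : ℕ} [NeZero L] {g : CuspForm (Gamma0 L) 2}
    (hg : IsNewform0 g) (h : HasDegreeLE g 1) :
    ∀ m : ℕ, ∃ a : ℤ, (qExpansion 1 ⇑g).coeff m = (a : ℂ) := by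
  intro m
  obtain ⟨hfd, hle⟩ := h
  haveI := hfd
  have h1 : Module.finrank ℚ (coeffField g) = 1 := le_antisymm hle Module.finrank_pos
  have hbot : coeffField g = ⊥ := IntermediateField.finrank_eq_one_iff.mp h1
  have hmem : (qExpansion 1 ⇑g).coeff m ∈ (⊥ : IntermediateField ℚ ℂ) :=
    hbot ▸ coeff_mem_coeffField g m
  rw [IntermediateField.mem_bot] at hmem
  obtain ⟨q, hq⟩ := hmem
  have hint : IsIntegral ℤ ((qExpansion 1 ⇑g).coeff m) := IsNewform0.isIntegral_coeff_holds hg m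
  rw [← hq] at hint
  have hqint : IsIntegral ℤ q :=
    (isIntegral_algebraMap_iff (algebraMap ℚ ℂ).injective).mp hint
  obtain ⟨a, ha⟩ := (IsIntegrallyClosed.isIntegral_iff (R := ℤ) (K := ℚ)).mp hqint
  refine ⟨a, ?_⟩
  rw [← hq, ← ha]
  simp

/-! ## The rational sector: PROVED from the landed theorems of line `birth` -/

/-- **Rational death** (no stub): GIVEN modularity (`exists_isNewformOf`) and the finiteness of
deep congruences to a fixed curve (`DeepCongruenceFinite`, Mordell–Faltings + Carayol), for `W/ℚ`
globally minimal elliptic and `p ≥ 5` good ordinary with `E[p]` irreducible there is a depth `n₃`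
beyond which NO rational (`degree ≤ 1`) newform `g ≠ f_W` of squarefree-coprime level `N_W·M` is
congruent to `W`. Proof: the finitely many rational congruent pairs at depth `2`
(`Theorems.stub_rationalSectorFinite`, with `eichlerShimuraConstruction_of_exists_isNewformOf`) each
die at some depth (`Theorems.stub_depthRigidity`); take the maximum. -/
theorem rationalDeath (hMod : exists_isNewformOf) (hDC : DeepCongruenceFinite) :
    ∀ (W : WeierstrassCurve ℚ) [W.IsElliptic] [W.IsGloballyMinimal] (p : ℕ) [Fact p.Prime],
      5 ≤ p → W.HasGoodReductionAtPrime p → ¬ (p : ℤ) ∣ W.frobeniusTrace p →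
      W.HasIrreducibleModPGaloisRep p →
      ∃ n₃ : ℕ, ∀ n : ℕ, n₃ ≤ n → ∀ (M : ℕ) [NeZero (W.conductorNorm ℤ * M)]
        (g : CuspForm (Gamma0 (W.conductorNorm ℤ * M)) 2),
        IsRaisedNewform W p M g → CongruentAt W p n M g → ¬ HasDegreeLE g 1 := by
  intro W _ _ p _ h5 hgood hord hirr
  classical
  have hES : eichlerShimuraConstruction := eichlerShimuraConstruction_of_exists_isNewformOf hMod
  obtain ⟨nr, hr⟩ := Theorems.stub_rationalSectorFinite hES hDC W p h5 hgood hord hirr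
  -- every member of the finite rational set with a `q`-expansion mismatch dies at some depth (stub K)
  have hdie : ∀ x ∈ {x : Σ M : ℕ, CuspForm (CongruenceSubgroup.Gamma0 (W.conductorNorm ℤ * M)) 2 |
        ∃ (_ : NeZero (W.conductorNorm ℤ * x.1)) (R : Subring ℂ) (φ : R →+* ZMod (p ^ nr)) (hR : ∀ ℓ : ℕ, ℓ.Prime → ¬ ℓ ∣ W.conductorNorm ℤ * x.1 → heckeEigenvalue x.2 ℓ ∈ R), (∀ m : ℕ, ∃ a : ℤ, (qExpansion 1 ⇑(x.2)).coeff m = (a : ℂ)) ∧ Squarefree x.1 ∧ Nat.Coprime x.1 (p * W.conductorNorm ℤ) ∧ IsNewform0 x.2 ∧ (∀ (ℓ : ℕ) (hℓ : ℓ.Prime) (hℓL : ¬ ℓ ∣ W.conductorNorm ℤ * x.1), φ ⟨heckeEigenvalue x.2 ℓ, hR ℓ hℓ hℓL⟩ = ((W.frobeniusTrace ℓ : ℤ) : ZMod (p ^ nr)))},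
      ∃ k : ℕ, (∃ m : ℕ, (qExpansion 1 ⇑(x.2)).coeff m ≠ ((W.LFunction m : ℤ) : ℂ)) →
        ∀ j : ℕ, k ≤ j → ¬ CongruentAt W p j x.1 x.2 := by
    rintro ⟨M, g⟩ hx
    obtain ⟨hM, R, φ, hR, hint, hsq, hcop, hnew, hcong⟩ := hx
    haveI := hM
    by_cases hmis : ∃ m : ℕ, (qExpansion 1 ⇑g).coeff m ≠ ((W.LFunction m : ℤ) : ℂ)
    · obtain ⟨k, hk⟩ := Theorems.stub_depthRigidity hMod W p M g hnew hmis
      refine ⟨k, fun _ j hkj hcj => ?_⟩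
      obtain ⟨_, R', φ', hR', hcong'⟩ := CongruentAt.mono hkj hcj
      exact hk R' φ' hR' hcong'
    · exact ⟨0, fun h => (hmis h).elim⟩
  choose! f hf using hdie
  refine ⟨max nr (hr.toFinset.sup f), fun n hn M hM g hraised hcongr hdeg => ?_⟩
  obtain ⟨hsq, hcop, hnew, hmis⟩ := hraised
  have hint : ∀ m : ℕ, ∃ a : ℤ, (qExpansion 1 ⇑g).coeff m = (a : ℂ) :=
    intCoeff_of_hasDegreeLE_one hnew hdeg
  -- `(M, g)` lies in the finite rational set (restrict the congruence to depth `nr ≤ n`)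
  obtain ⟨_, R, φ, hR, hcong⟩ := CongruentAt.mono ((le_max_left _ _).trans hn) hcongr
  have hx : (⟨M, g⟩ : Σ M : ℕ, CuspForm (CongruenceSubgroup.Gamma0 (W.conductorNorm ℤ * M)) 2) ∈
      {x : Σ M : ℕ, CuspForm (CongruenceSubgroup.Gamma0 (W.conductorNorm ℤ * M)) 2 |
        ∃ (_ : NeZero (W.conductorNorm ℤ * x.1)) (R : Subring ℂ) (φ : R →+* ZMod (p ^ nr)) (hR : ∀ ℓ : ℕ, ℓ.Prime → ¬ ℓ ∣ W.conductorNorm ℤ * x.1 → heckeEigenvalue x.2 ℓ ∈ R), (∀ m : ℕ, ∃ a : ℤ, (qExpansion 1 ⇑(x.2)).coeff m = (a : ℂ)) ∧ Squarefree x.1 ∧ Nat.Coprime x.1 (p * W.conductorNorm ℤ) ∧ IsNewform0 x.2 ∧ (∀ (ℓ : ℕ) (hℓ : ℓ.Prime) (hℓL : ¬ ℓ ∣ W.conductorNorm ℤ * x.1), φ ⟨heckeEigenvalue x.2 ℓ, hR ℓ hℓ hℓL⟩ = ((W.frobeniusTrace ℓ : ℤ) : ZMod (p ^ nr)))} :=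
    ⟨hM, R, φ, hR, hint, hsq, hcop, hnew, hcong⟩
  have hle : f ⟨M, g⟩ ≤ n :=
    (Finset.le_sup (f := f) (hr.mem_toFinset.mpr hx)).trans ((le_max_right _ _).trans hn)
  exact hf _ hx hmis n hle hcongr

/-! ## Registered stubs -/

/-- **M · `stub_modularity`** — the Modularity Theorem, Version `L` (BCDT 2001 Thm. A): VERBATIM the
named Literature fact `exists_isNewformOf` (not discharged in the tree). X-sized fact-stub, never
briefed; consumed by `rationalDeath`. [cite: BreuilConradDiamondTaylor2001, Thm. A] -/
theorem stub_modularity : exists_isNewformOf := by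
  sorry

/-- **DC · `stub_deepCongruenceFinite`** — finiteness of deep congruences to a fixed elliptic curve
(Mordell–Faltings on the twists `X_E^α(pⁿ)`, `pⁿ ≥ 7`, + Carayol): VERBATIM the named Literature fact
`DeepCongruenceFinite` (`DeepCongruenceFiniteness.lean`, not discharged). X-sized fact-stub, never
briefed; consumed by `rationalDeath`. [cite: Faltings1983Endlichkeit, Satz 7] -/
theorem stub_deepCongruenceFinite : DeepCongruenceFinite := by
  sorry

/-- **S1 · `stub_conjugateZeros` — central vanishing is Galois-invariant (Shimura 1977, Thm. 1;
THEOREM).** If `g, g'` are newforms of the same level `Γ₀(L)`, `g'` a Galois conjugate of `g`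
(`aₘ(g') = σ(aₘ(g))` for a ring automorphism `σ` of `ℂ`), and `L(g, 1) = 0` (entire continuation of
`Σ aₘ(g) m^{-s}` vanishing at `1`), then `L(g', 1) = 0`. Print proof (weight 2): `L(g,1)` is a
non-zero multiple of the modular symbol `{0, ∞}(g)`; the winding element `{0,∞}` is a RATIONAL
homology class (Manin–Drinfeld, in tree), the Hecke action on `H₁(X₀(L), ℚ)` is `ℚ`-rational, so the
vanishing of the `g`-component of `{0,∞} ⊗ 1 ∈ H₁ ⊗_{T_ℚ, λ_g} K_g` is a statement over `K_g`
transported by `σ`; Shimura's `{∞, r}_g = q⁺Ω⁺ + q⁻Ω⁻i`, `q^± ∈ K_g`, `Ω^± ≠ 0`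
(`NewformPeriodsCoeffField.lean`) is the tree's form of the input. L-sized.
[cite: Shimura1977, Thm. 1] [cite: Manin1972, Cor. 3.6] -/
theorem stub_conjugateZeros :
    ∀ (L : ℕ) [NeZero L] (g g' : CuspForm (Gamma0 L) 2),
      IsNewform0 g → IsNewform0 g' → IsConjugate g g' → HasCentralZero g → HasCentralZero g' := by
  sorry

/-- **S3 · `stub_boundedDegreeGrowth` — deep congruences have large degree (the DIOPHANTINE stub;
`L`-free, sign-free).** For `W/ℚ` globally minimal elliptic, `p ≥ 5` good ordinary with `E[p]`
irreducible, and every `d`, there is a depth `n₂ = n₂(W, p, d)` such that for `n ≥ n₂` no IRRATIONAL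
newform `g` of squarefree-coprime level `N_W·M` (with `q`-expansion `≠ (aₘ(W))ₘ`) of degree
`[ℚ(aₘ(g)) : ℚ] ≤ d` is depth-`n` congruent to `W`. Why plausibly true: a degree-`d` newform congruent
to `W` mod `𝔭ⁿ` gives (Carayol, absolute irreducibility of `E[p]`) an abelian variety `A_g` of
dimension `≤ d` with `A_g[𝔭ⁿ] ≅ E[pⁿ]`, i.e. a `ℚ`-point on a twist of a Hilbert–Blumenthal variety
with full level-`pⁿ` structure, of general type and hyperbolic for `pⁿ ≫_d 0` (Brunebarbe 2020;
Abramovich–Várilly-Alvarado 2017), so LANG–VOJTA leaves finitely many `g`, each of bounded depth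
(stub K). Why it might fail: it is Lang–Vojta-complete for `d ≥ 2` (unconditional only for `d = 1`,
Faltings — `rationalDeath` — and for the `ℚ`-curve part of `d = 2`, Abramovich gonality + Faltings).
Research-sized (conditional engine named). [cite: Brunebarbe2020, Thm. 1.1]
[cite: AbramovichVarillyAlvarado2017, Thm. 1.1] [cite: Faltings1983Endlichkeit, Satz 7] -/
theorem stub_boundedDegreeGrowth :
    ∀ (W : WeierstrassCurve ℚ) [W.IsElliptic] [W.IsGloballyMinimal] (p : ℕ) [Fact p.Prime],
      5 ≤ p → W.HasGoodReductionAtPrime p → ¬ (p : ℤ) ∣ W.frobeniusTrace p →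
      W.HasIrreducibleModPGaloisRep p →
      ∀ d : ℕ, ∃ n₂ : ℕ, ∀ n : ℕ, n₂ ≤ n → ∀ (M : ℕ) [NeZero (W.conductorNorm ℤ * M)]
        (g : CuspForm (Gamma0 (W.conductorNorm ℤ * M)) 2),
        IsRaisedNewform W p M g → CongruentAt W p n M g → ¬ HasDegreeLE g 1 → ¬ HasDegreeLE g d := by
  sorry

/-- **S2 · `stub_largeOrbitNonvanishing` — large deep even-sign congruence orbits do not vanish
entirely (the ANALYTIC stub; the open core of this line).** For `W/ℚ` globally minimal elliptic and
`p ≥ 5` good ordinary with `E[p]` irreducible there are `d₀ = d₀(W, p)` and `n₁` such that for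
`n ≥ n₁`, every even-sign (Fricke eigenvalue `−1`) newform `g` of squarefree-coprime level `N_W·M`
(`q`-expansion `≠ (aₘ(W))ₘ`), depth-`n` congruent to `W`, of degree `> d₀`, has a Galois-conjugate
NEWFORM `g'` of the same level with `L(g', 1) ≠ 0`. Intended mechanism: (a) DOMINANCE — a deep
congruence orbit of large degree occupies all but a bounded part of its Atkin–Lehner sign class at
level `N_W·M` (level-aspect Maeda: K. Martin 2021; large simple Hecke modules detected by congruences:
Lipnowski–Schaeffer 2020; orbit counts with prescribed local types: Dieulefait–Pacetti–Tsaknias 2021);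
(b) uniform POSITIVE PROPORTION of non-vanishing central values among even forms in the squarefree
level aspect (Iwaniec–Sarnak 2000, harmonic proportion `≥ 1/2`), refined to a fixed Atkin–Lehner
class. (a)+(b): a dominant orbit contains a form with `L ≠ 0`. Why it might fail: (a) is a Maeda-type
conjecture in the level aspect (open; at non-squarefree `N_W` the sign class must be refined by local
inertial types because quadratic twists of conductor `c`, `c² ∣ N_W`, permute orbits), and nothing
known forbids a sequence of accidental zeros with degree AND depth → ∞. Research-sized (open).
[cite: IwaniecSarnak2000, Thm. 1 / Cor. 13] [cite: Martin2021Maeda, Conjecture 1 and Thm. 2]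
[cite: LipnowskiSchaeffer2020, Thm. 1.1] -/
theorem stub_largeOrbitNonvanishing :
    ∀ (W : WeierstrassCurve ℚ) [W.IsElliptic] [W.IsGloballyMinimal] (p : ℕ) [Fact p.Prime],
      5 ≤ p → W.HasGoodReductionAtPrime p → ¬ (p : ℤ) ∣ W.frobeniusTrace p →
      W.HasIrreducibleModPGaloisRep p →
      ∃ d₀ n₁ : ℕ, ∀ n : ℕ, n₁ ≤ n → ∀ (M : ℕ) [NeZero (W.conductorNorm ℤ * M)]
        (g : CuspForm (Gamma0 (W.conductorNorm ℤ * M)) 2),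
        IsRaisedNewform W p M g → HasEvenSign W M g → CongruentAt W p n M g → ¬ HasDegreeLE g d₀ →
        ∃ g' : CuspForm (Gamma0 (W.conductorNorm ℤ * M)) 2,
          IsNewform0 g' ∧ IsConjugate g g' ∧ ¬ HasCentralZero g' := by
  sorry

/-! ## Stub statements by name -/

namespace Statement

/-- Statement of `stub_modularity` (= `exists_isNewformOf`). -/
abbrev stub_modularity : Prop := type_of% @OrbitDichotomy.stub_modularity
/-- Statement of `stub_deepCongruenceFinite` (= `DeepCongruenceFinite`). -/
abbrev stub_deepCongruenceFinite : Prop := type_of% @OrbitDichotomy.stub_deepCongruenceFinite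
/-- Statement of `stub_conjugateZeros`. -/
abbrev stub_conjugateZeros : Prop := type_of% @OrbitDichotomy.stub_conjugateZeros
/-- Statement of `stub_boundedDegreeGrowth`. -/
abbrev stub_boundedDegreeGrowth : Prop := type_of% @OrbitDichotomy.stub_boundedDegreeGrowth
/-- Statement of `stub_largeOrbitNonvanishing`. -/
abbrev stub_largeOrbitNonvanishing : Prop := type_of% @OrbitDichotomy.stub_largeOrbitNonvanishing

end Statement

/-! ## The composition (sorry-free): trichotomy in the degree -/

/-- **`IsolationOfAccidentalZeros_of`** — the five stub STATEMENTS (modularity M, deep-congruence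
finiteness DC, conjugate zeros S1, bounded-degree growth S3, large-orbit non-vanishing S2) imply the
crux, BY NAME. Given `(W, p)`: S2 gives `d₀, n₁`; S3 at `d := d₀` gives `n₂`; `rationalDeath` (from
M, DC and the landed theorems) gives `n₃`. For `n ≥ max n₁ n₂ n₃` a depth-`n` shadow `(M, g)` has
degree `≤ 1` (impossible: `rationalDeath`), or `≤ d₀` and irrational (impossible: S3), or `> d₀` —
then S2 produces a conjugate newform with `L ≠ 0` while S1 transports the shadow's central zero to
it. -/
theorem IsolationOfAccidentalZeros_of (hMod : Statement.stub_modularity)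
    (hDC : Statement.stub_deepCongruenceFinite) (hS1 : Statement.stub_conjugateZeros)
    (hS3 : Statement.stub_boundedDegreeGrowth) (hS2 : Statement.stub_largeOrbitNonvanishing) :
    IsolationOfAccidentalZeros := by
  intro W _ _ p _ h5 hgood hord hirr
  classical
  obtain ⟨d₀, n₁, h2⟩ := hS2 W p h5 hgood hord hirr
  obtain ⟨n₂, h3⟩ := hS3 W p h5 hgood hord hirr d₀
  obtain ⟨n₃, hrat⟩ := rationalDeath hMod hDC W p h5 hgood hord hirr
  refine ⟨max n₁ (max n₂ n₃), fun n hn => ?_⟩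
  have hn₁ : n₁ ≤ n := (le_max_left _ _).trans hn
  have hn₂ : n₂ ≤ n := ((le_max_left _ _).trans (le_max_right _ _)).trans hn
  have hn₃ : n₃ ≤ n := ((le_max_right _ _).trans (le_max_right _ _)).trans hn
  rintro ⟨M, hM, g, R, φ, hR, hsq, hcop, hnew, hmis, hfr, hcong, hΛ⟩
  haveI := hM
  have hraised : IsRaisedNewform W p M g := ⟨hsq, hcop, hnew, hmis⟩
  have hcongr : CongruentAt W p n M g := ⟨hM, R, φ, hR, hcong⟩
  have heven : HasEvenSign W M g := hfr
  have hzero : HasCentralZero g := hΛ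
  by_cases h1 : HasDegreeLE g 1
  · exact hrat n hn₃ M g hraised hcongr h1
  by_cases hd : HasDegreeLE g d₀
  · exact h3 n hn₂ M g hraised hcongr h1 hd
  · obtain ⟨g', hg', hconj, hnz⟩ := h2 n hn₁ M g hraised heven hcongr hd
    exact hnz (hS1 _ g g' hnew hg' hconj hzero)

/-- The crux along this line, MODULO the five registered stubs (sorries live only in `stub_*`). -/
theorem IsolationOfAccidentalZeros_proof : IsolationOfAccidentalZeros :=
  IsolationOfAccidentalZeros_of stub_modularity stub_deepCongruenceFinite stub_conjugateZeros
    stub_boundedDegreeGrowth stub_largeOrbitNonvanishing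

end Summit.BirchSwinnertonDyer.BirchSwinnertonDyer.Cruxes.IsolationOfAccidentalZeros.OrbitDichotomy

end
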